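import Mathlib
import HarnessLib
import Summits.ValiantsHypothesis.ValiantsHypothesis.Theses.MonotoneRestoration
import Literature.Computability.AlgebraicComplexity.ArithCircuit
import Literature.Computability.AlgebraicComplexity.ArithCircuitProofs
import Literature.Computability.AlgebraicComplexity.MonotoneStructure
import Literature.Computability.AlgebraicComplexity.PermanentIrreducible
import Literature.ModelTheory.FiniteModelTheory.CkEquiv
import Summits.ValiantsHypothesis.ValiantsHypothesis.Theorems.MonotoneRestorationMonotoneRestorationQPCosetCount
import Summits.ValiantsHypothesis.ValiantsHypothesis.Theorems.MonotoneRestorationMonotoneRestorationQPSymmetricLB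
import Summits.ValiantsHypothesis.ValiantsHypothesis.Theorems.MonotoneRestorationMonotoneRestorationQPSupportSymmetrisation
import Summits.ValiantsHypothesis.ValiantsHypothesis.Theorems.MonotoneRestorationMonotoneRestorationQPSparseRegime
import Summits.ValiantsHypothesis.ValiantsHypothesis.Theorems.MonotoneRestorationMonotoneRestorationQPBeta
import Literature.Computability.AlgebraicComplexity.SymmetricArithCircuit
import Literature.Computability.AlgebraicComplexity.DawarWilsenach2025Proofs
import Literature.GroupTheory.PermutationGroups.SmallIndexSubgroups
import Summits.ValiantsHypothesis.ValiantsHypothesis.Theorems.MonotoneRestorationQP.Negative.LoadBearing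
import Summits.ValiantsHypothesis.ValiantsHypothesis.Theorems.MonotoneRestorationMonotoneRestorationQPPermSupportCount

/-! TTRL-lite variant V20204 of stmt-ValiantsHypothesis-15886 -/

namespace Summit.ValiantsHypothesis.ValiantsHypothesis.Theorems

open Summit.ValiantsHypothesis.ValiantsHypothesis.Theses.MonotoneRestoration
open Literature.Computability.AlgebraicComplexity

/-- TTRL-lite variant V20204 of `stub_esymmRowSums_structure` (stmt-ValiantsHypothesis-15886):
transporting the row-sum substitution of the elementary symmetric polynomial `e_k` from `ℝ≥0`
coefficients to `ℂ` coefficients along `Complex.ofRealHom.comp NNReal.toRealHom` gives the same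
construction carried out directly over `ℂ` (`MvPolynomial.map_bind₁` + `MvPolynomial.map_esymm`). -/
theorem stub_esymmRowSums_structure_var20204 :
    ∀ (n k : ℕ), MvPolynomial.map (Complex.ofRealHom.comp NNReal.toRealHom)
      (MvPolynomial.bind₁ (fun i : Fin n => ∑ j : Fin n, MvPolynomial.X (i, j))
        (MvPolynomial.esymm (Fin n) NNReal k)) =
      MvPolynomial.bind₁ (fun i : Fin n => ∑ j : Fin n, MvPolynomial.X (i, j))
        (MvPolynomial.esymm (Fin n) ℂ k) := by
  intro n k
  rw [MvPolynomial.map_bind₁, MvPolynomial.map_esymm]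
  simp only [map_sum, MvPolynomial.map_X]

end Summit.ValiantsHypothesis.ValiantsHypothesis.Theorems
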